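import Summits.QuantumFields.YangMills.Theorems.BalabanUVNodesN22W1RelCentredVertexHeredity

/-!
# BalabanUVNodes ∕ node N22 = NE9 — THE W1 OBJECT ON THE RELATIVE-DISC CENTRED ROAD (RE-TYPING M1′), MODULE R1c: CENTRED HEREDITY WITH A SLACK LETTER — the located numeric
# demand `Mv·‖z₀‖² ≤ ½` of R1b traded for `≤ Ks∕2` against the weight slack `(1+Ks)·e^{a₅|Z|} ≤ e^{a₅′|Z|}` (numerals at `a₅ + log(1+Ks)`); letter `(2∕Ks)·Mv‖z₀‖²·A·e^{−κd}`

Cell `pub-ymgap`, HUMAN RULING D-0062 (Track A), R134 ACCELERATION re-seat `pub-ymgap-dag-n22-c` (strategy s1), generation 6, file R1c of the re-typed line.  THEOREMS ONLY; imports R1b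
`…N22W1RelCentredVertexHeredity` (R1a §2 `holoBound_recTerm_ofTerms`, R1b §1 `recTerm_ofTerms_congr_step`) BY NAME.  `--supports` K3⁗ `SpineGivenEndpointR13Sep` (stmt-QuantumFields-20292) as a helper.

WHY.  R1b ∕ R2 ∕ R2b carry the located numeric demand `Mv·((1+cA)·θ.γ)² ≤ ½` (the window radius small against the vertex curvature), which comes from running the interpolation tower with the
weight at most DOUBLED.  Allowing the weight to grow by a factor `1 + Ks` on the interpolation ball `ball 0 (Ks·ρ∕(Mv‖z₀‖²))` instead relaxes the demand to `Mv‖z₀‖² ≤ Ks∕2` for ANY `Ks > 0` —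
paid only in the socket numerals, asked at `a₅′` with `(1+Ks)·e^{a₅|Z|} ≤ e^{a₅′|Z|}` (i.e. `a₅′ = a₅ + log(1+Ks)`, domains being non-empty) — and IMPROVES the letter to `(2∕Ks)·Mv‖z₀‖²·A·e^{−κd}`.
Same proof as R1b §2 (`Ks = 1` there).  A successor's engine ∕ leaf with the slack letter is then a re-assembly of R2 ∕ R2b on this theorem (trigger (t6) of the seat's HANDOFF).

HONEST FRAMING.  Count-neutral by-name knit AT THE OBJECT; NOT a discharge of N22; every schema DISPLAYED ((S-vertex-T′) NOT PRINTED); NE9 NOT IN PRINT for d = 4; one finite four-torus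
programme at fixed ε — NOT infinite volume, NOT OS on ℝ⁴, NOT a mass gap, NOT Clay.  0 `sorry`, 0 `def`, standard axioms.

References (TYPES only): [I] = [Balaban1987RG1] §0 p. 256, §1 p. 263, (2.9) p. 266, (2.10) p. 267, (2.13) p. 268; [II] = [Balaban1988RG2Cluster] (1.41) p. 11, (2.9)–(2.14) pp. 14–15,
(2.26) p. 17, Lemma 3 (2.38) p. 20, (2.39)–(2.41) p. 21.
-/

noncomputable section

namespace YMDAG.N22.W1

open Set Metric
open scoped BigOperators
open Literature.MathematicalPhysics.QuantumFieldTheory.Balaban1983to89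
open Literature.MathematicalPhysics.QuantumFieldTheory.Balaban1983to89.T4Continuum (T4Family)
open Literature.MathematicalPhysics.QuantumFieldTheory.Balaban1983to89.T4OutputRate
open Literature.MathematicalPhysics.QuantumFieldTheory.Balaban1983to89.TreeLengthTorus (TPt TDom tsys torusTreeLen torusTreeLen_nonneg)
open Literature.MathematicalPhysics.QuantumFieldTheory.Balaban1983to89.B12TreeDecay (K₀ K₀_pos)
open Literature.MathematicalPhysics.QuantumFieldTheory.Balaban1983to89.B13Lemma3TorusData (TBond)
open Literature.MathematicalPhysics.QuantumFieldTheory.Balaban1983to89.B13Lemma3TorusTerms (terms weight weight_nonneg)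
open Literature.MathematicalPhysics.QuantumFieldTheory.Balaban1983to89.B13Lemma3TorusSocket (Lemma3Numerics)
open Literature.MathematicalPhysics.QuantumFieldTheory.Balaban1983to89.Node00
open Literature.MathematicalPhysics.QuantumFieldTheory.Balaban1983to89.Node00.Sect2 (domSys domCount CPair)
open Literature.MathematicalPhysics.QuantumFieldTheory.Balaban1983to89.Node00.W1

variable (F : T4Family) (K : ℕ) {𝔸 : Type*} {M : ℕ} [NeZero M] (L : ℕ) [NeZero L]

/-! ## §1 CENTRED HEREDITY WITH A SLACK LETTER `K`: the vertex letter `(2∕K)·Mv‖z₀‖²·A·e^{−κd}` under `Mv‖z₀‖² ≤ K∕2`, weight slack `(1+K)·e^{a₅|Z|} ≤ e^{a₅′|Z|}` -/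

open Classical in
/-- **THE CENTRED LETTER OF EVERY LEVEL FROM THE PER-TERM VERTEX SCHEMA, WITH A SLACK LETTER `Ks`** (R1b's `centred_recTerm_ofTerms` is the case `Ks = 1`): the weight slack is
`(1+Ks)·e^{a₅|Z|} ≤ e^{a₅′|Z|}` (met by `a₅′ = a₅ + log (1+Ks)`), the smallness is `Mv‖z₀‖² ≤ Ks∕2`, and the letter is `(2∕Ks)·Mv‖z₀‖²·A·e^{−κd}` — so the leaf's located
demand `Mv·((1+cA)γ)² ≤ ½` can be traded for `≤ Ks∕2` at the price of the socket numerals at `a₅ + log(1+Ks)` (interpolation ball `ball 0 (Ks·ρ∕(Mv‖z₀‖²))`).  ORIGINAL DOCSTRING:**  Setting of R1a §2 at the letter `a₅′` (the socket numerals are asked at `a₅′`, the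
per-term weight bounds displayed at `a₅` with the slack `2·e^{a₅|Z|} ≤ e^{a₅′|Z|}` — one letter of room for the interpolation), PLUS: a coupling-BLIND centre functional `V k′ Z t old φ`
per step (the one-sided limit of the term at zero coupling — lens T13′: typed FREE, never as the evaluation at `s = 0`), (S-226-T′) for `TF` at every complex last coupling `u ∈ D k′` AND for
`V`, both on EVERY open set along every holomorphic (1.18)-bounded older-term curve (structural), and the CENTRED half of (S-vertex-T′): ‖TF k′ Z t z old φ − V k′ Z t old φ‖ ≤
Mv·‖z‖²·weight(t)·e^{a₅|Z|} for `z ∈ D k′` and every (1.18)-bounded older-term family (order two in `g`: [I] (2.13) p. 268 «vanishes at `g_k = 0`» + parity `(g, B) ↦ (−g, −B)`, lens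
T5∕T14 — NOT PRINTED).  CONCLUSION: at every level `j ≤ Kr`, real window history `g`, young coupling `i < j`, `X`, `φ ∈ sp j X` and `z₀ ∈ D i` with `0 < Mv`, `z₀ ≠ 0`,
`Mv·‖z₀‖² ≤ ½`: ‖recTerm G (↑g|i:=z₀) j X φ − recTerm G_V ↑g j X φ‖ ≤ 2·Mv·‖z₀‖²·A·e^{−κ d_j(X)}, where `G_V := GenTower.ofTerms L (TF | i := V i)` is the VERTEX TOWER for the
coupling `g_i` (its terms do not read `g_i`) — UNIFORMLY IN THE AGE `j − i`.  Proof: the interpolation tower `TF | i := (V i + (s∕ρ)·(TF i …z₀… − V i))`, `ρ := γ + 1`, is a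
term-functional family to which R1a §2 applies with the domain of the coupling `i` replaced by `ball 0 (ρ∕(Mv‖z₀‖²))` (affine in the mock coupling; weight at most doubled there by the
centred letter — the displayed slack); its level-`j` section in the mock coupling is holomorphic on that ball and bounded by `A·e^{−κd}` (R1a §2), equals the true section at `g_i = z₀` at
the mock coupling `ρ` and the vertex tower's term at `0` (§1); the Schwarz lemma on the ball gives the letter. [cite: Balaban1987RG1, §0 p.256, §1 p.263, (2.9) p.266, (2.10) p.267 and (2.13) p.268; Balaban1988RG2Cluster, (1.41) p.11, (2.14) p.15, (2.26) p.17 and (2.39)-(2.41) p.21] -/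
theorem centred_recTerm_ofTerms_slack (TF : GenTermFun (F.P K) 𝔸 M L)
    (V : (k : ℕ) → (domSys (F.P K) M (k + 1)).Dom → TermLabel (F.P K) M k L → OlderTerms (F.P K) 𝔸 M k → CPair (F.P K) 𝔸 → ℂ)
    (sp : (j : ℕ) → (domSys (F.P K) M j).Dom → Set (CPair (F.P K) 𝔸))
    (c : B13.Consts) (hL : 8 ≤ c.L) (hLc : c.L = L) {a a₂ a₂' a₅ a₅' Aabs : ℝ} (hN : Lemma3Numerics c M ((c.L : ℝ) / 2) a a₂ a₂' a₅' Aabs)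
    {γ A κ r₁ Mv Ks : ℝ} (hKs : 0 < Ks) (hA0 : 0 ≤ c.C3act * c.ε₁) (hr₁ : 0 ≤ r₁) (hκ : κ ≤ r₁)
    (hrate : r₁ + 2 * (64 * Real.log 162) + 2 ≤ (1 - 8 * c.δ) * ((c.L : ℝ) / 2) * c.κ)
    (hsmall : c.C3act * c.ε₁ * Real.exp (5 * r₁ + 1) * K₀ 64 8 * 9 * 64 ≤ 1)
    (hrenew : Real.exp 1 * 9 * 64 * K₀ 64 8 ^ 2 * (c.C3act * c.ε₁) ≤ A)
    (hKw : ∀ (k' : ℕ) (Z : (domSys (F.P K) M (k' + 1)).Dom), (1 + Ks) * Real.exp (a₅ * ((Z.1).card : ℝ)) ≤ Real.exp (a₅' * ((Z.1).card : ℝ)))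
    (D : ℕ → Set ℂ) (hDo : ∀ i, IsOpen (D i)) (hDw : ∀ (i : ℕ), ∀ t ∈ Ioc (0 : ℝ) γ, ((t : ℝ) : ℂ) ∈ D i) (Kr : ℕ)
    (hlast : ∀ k' : ℕ, k' < Kr → ∀ old : OlderTerms (F.P K) 𝔸 M k',
      (∀ (j : Fin (k' + 1)) (Y : (domSys (F.P K) M j).Dom) (ψ : CPair (F.P K) 𝔸), ψ ∈ sp j Y → ‖old j Y ψ‖ ≤ A * Real.exp (-(κ * torusTreeLen Y.1))) →
      ∀ (X : (domSys (F.P K) M (k' + 1)).Dom) (φ : CPair (F.P K) 𝔸), φ ∈ sp (k' + 1) X → ∀ (Z : (domSys (F.P K) M (k' + 1)).Dom), Z.1 ⊆ X.1 → ∀ t ∈ terms L M Z,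
        DifferentiableOn ℂ (fun z => TF k' Z t z old φ) (D k') ∧ ∀ z ∈ D k', ‖TF k' Z t z old φ‖ ≤ weight L M c Z a t * Real.exp (a₅ * ((Z.1).card : ℝ)))
    (hprop : ∀ k' : ℕ, k' < Kr → ∀ i : ℕ, i < k' → ∀ (O : Set ℂ), IsOpen O → ∀ u ∈ D k', ∀ cv : ℂ → OlderTerms (F.P K) 𝔸 M k',
      (∀ (j : Fin (k' + 1)) (Y : (domSys (F.P K) M j).Dom) (ψ : CPair (F.P K) 𝔸), ψ ∈ sp j Y →
        DifferentiableOn ℂ (fun z => cv z j Y ψ) O ∧ ∀ z ∈ O, ‖cv z j Y ψ‖ ≤ A * Real.exp (-(κ * torusTreeLen Y.1))) →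
      ∀ (X : (domSys (F.P K) M (k' + 1)).Dom) (φ : CPair (F.P K) 𝔸), φ ∈ sp (k' + 1) X → ∀ (Z : (domSys (F.P K) M (k' + 1)).Dom), Z.1 ⊆ X.1 → ∀ t ∈ terms L M Z,
        DifferentiableOn ℂ (fun z => TF k' Z t u (cv z) φ) O ∧ ∀ z ∈ O, ‖TF k' Z t u (cv z) φ‖ ≤ weight L M c Z a t * Real.exp (a₅ * ((Z.1).card : ℝ)))
    (hpropV : ∀ k' : ℕ, k' < Kr → ∀ (O : Set ℂ), IsOpen O → ∀ cv : ℂ → OlderTerms (F.P K) 𝔸 M k',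
      (∀ (j : Fin (k' + 1)) (Y : (domSys (F.P K) M j).Dom) (ψ : CPair (F.P K) 𝔸), ψ ∈ sp j Y →
        DifferentiableOn ℂ (fun z => cv z j Y ψ) O ∧ ∀ z ∈ O, ‖cv z j Y ψ‖ ≤ A * Real.exp (-(κ * torusTreeLen Y.1))) →
      ∀ (X : (domSys (F.P K) M (k' + 1)).Dom) (φ : CPair (F.P K) 𝔸), φ ∈ sp (k' + 1) X → ∀ (Z : (domSys (F.P K) M (k' + 1)).Dom), Z.1 ⊆ X.1 → ∀ t ∈ terms L M Z,
        DifferentiableOn ℂ (fun z => V k' Z t (cv z) φ) O ∧ ∀ z ∈ O, ‖V k' Z t (cv z) φ‖ ≤ weight L M c Z a t * Real.exp (a₅ * ((Z.1).card : ℝ)))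
    (hcen : ∀ k' : ℕ, k' < Kr → ∀ old : OlderTerms (F.P K) 𝔸 M k',
      (∀ (j : Fin (k' + 1)) (Y : (domSys (F.P K) M j).Dom) (ψ : CPair (F.P K) 𝔸), ψ ∈ sp j Y → ‖old j Y ψ‖ ≤ A * Real.exp (-(κ * torusTreeLen Y.1))) →
      ∀ (X : (domSys (F.P K) M (k' + 1)).Dom) (φ : CPair (F.P K) 𝔸), φ ∈ sp (k' + 1) X → ∀ (Z : (domSys (F.P K) M (k' + 1)).Dom), Z.1 ⊆ X.1 → ∀ t ∈ terms L M Z,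
        ∀ z ∈ D k', ‖TF k' Z t z old φ - V k' Z t old φ‖ ≤ Mv * ‖z‖ ^ 2 * (weight L M c Z a t * Real.exp (a₅ * ((Z.1).card : ℝ))))
    (hMv : 0 < Mv) :
    ∀ (j : ℕ), j ≤ Kr → ∀ (g : ℕ → ℝ), g ∈ Window γ → ∀ (i : ℕ), i < j → ∀ (X : (domSys (F.P K) M j).Dom) (φ : CPair (F.P K) 𝔸), φ ∈ sp j X →
      ∀ z₀ ∈ D i, z₀ ≠ 0 → Mv * ‖z₀‖ ^ 2 ≤ Ks / 2 →
        ‖recTerm (GenTower.ofTerms L TF) (Function.update (fun n => ((g n : ℝ) : ℂ)) i z₀) j X φ -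
            recTerm (GenTower.ofTerms L (Function.update TF i fun Z t _ old φ => V i Z t old φ)) (fun n => ((g n : ℝ) : ℂ)) j X φ‖ ≤
          2 / Ks * (Mv * ‖z₀‖ ^ 2) * (A * Real.exp (-(κ * torusTreeLen X.1))) := by
  intro j hj g hg i hij X φ hφ z₀ hz₀ hz₀ne hq
  have hA6 : 0 ≤ c.α₆ * c.eps2 := mul_nonneg hN.hα₆.le hN.hε₀
  have hγ : 0 < γ := (hg 0).1.trans_le (hg 0).2
  -- letters of the interpolation
  set q : ℝ := Mv * ‖z₀‖ ^ 2 with hqdef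
  have hq0 : 0 < q := mul_pos hMv (pow_pos (norm_pos_iff.mpr hz₀ne) 2)
  set ρ : ℝ := γ + 1 with hρdef
  have hρ0 : 0 < ρ := by positivity
  set R : ℝ := Ks * ρ / q with hRdef
  have hR0 : 0 < R := div_pos (mul_pos hKs hρ0) hq0
  have hRρ : R * q = Ks * ρ := div_mul_cancel₀ (Ks * ρ) hq0.ne'
  have hρR : ρ < R := by
    rw [hRdef, lt_div_iff₀ hq0]
    nlinarith
  have hγR : γ < R := by linarith
  -- the upgraded weight letter
  have hexp : ∀ (k' : ℕ) (Z : (domSys (F.P K) M (k' + 1)).Dom), Real.exp (a₅ * ((Z.1).card : ℝ)) ≤ Real.exp (a₅' * ((Z.1).card : ℝ)) := fun k' Z =>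
    le_trans (by nlinarith [Real.exp_pos (a₅ * ((Z.1).card : ℝ))]) (hKw k' Z)
  have hw_up : ∀ (k' : ℕ) (Z : (domSys (F.P K) M (k' + 1)).Dom) (t : TermLabel (F.P K) M k' L) (x : ℝ),
      x ≤ weight L M c Z a t * Real.exp (a₅ * ((Z.1).card : ℝ)) → x ≤ weight L M c Z a t * Real.exp (a₅' * ((Z.1).card : ℝ)) := fun k' Z t x hx =>
    hx.trans (mul_le_mul_of_nonneg_left (hexp k' Z) (weight_nonneg c Z a hA6 t))
  have hw_two : ∀ (k' : ℕ) (Z : (domSys (F.P K) M (k' + 1)).Dom) (t : TermLabel (F.P K) M k' L) (x : ℝ),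
      x ≤ (1 + Ks) * (weight L M c Z a t * Real.exp (a₅ * ((Z.1).card : ℝ))) → x ≤ weight L M c Z a t * Real.exp (a₅' * ((Z.1).card : ℝ)) := fun k' Z t x hx =>
    hx.trans (by
      calc (1 + Ks) * (weight L M c Z a t * Real.exp (a₅ * ((Z.1).card : ℝ))) = weight L M c Z a t * ((1 + Ks) * Real.exp (a₅ * ((Z.1).card : ℝ))) := by ring
        _ ≤ weight L M c Z a t * Real.exp (a₅' * ((Z.1).card : ℝ)) := mul_le_mul_of_nonneg_left (hKw k' Z) (weight_nonneg c Z a hA6 t))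
  -- the uncentred bound of the centre at a bounded older-term family (from (S-226-T′) for `V` along a constant curve)
  have hVb : ∀ k' : ℕ, k' < Kr → ∀ old : OlderTerms (F.P K) 𝔸 M k',
      (∀ (j : Fin (k' + 1)) (Y : (domSys (F.P K) M j).Dom) (ψ : CPair (F.P K) 𝔸), ψ ∈ sp j Y → ‖old j Y ψ‖ ≤ A * Real.exp (-(κ * torusTreeLen Y.1))) →
      ∀ (X : (domSys (F.P K) M (k' + 1)).Dom) (φ : CPair (F.P K) 𝔸), φ ∈ sp (k' + 1) X → ∀ (Z : (domSys (F.P K) M (k' + 1)).Dom), Z.1 ⊆ X.1 → ∀ t ∈ terms L M Z,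
        ‖V k' Z t old φ‖ ≤ weight L M c Z a t * Real.exp (a₅ * ((Z.1).card : ℝ)) := fun k' hk old hold X φ hφ Z hZ t ht =>
    ((hpropV k' hk univ isOpen_univ (fun _ => old) (fun j Y ψ hψ => ⟨differentiableOn_const _, fun _ _ => hold j Y ψ hψ⟩) X φ hφ Z hZ t ht).2 0 (mem_univ _))
  -- THE INTERPOLATION TOWER and its domain family
  set TFs : GenTermFun (F.P K) 𝔸 M L :=
    Function.update TF i (fun Z t s old φ => V i Z t old φ + (s / (ρ : ℂ)) * (TF i Z t z₀ old φ - V i Z t old φ)) with hTFs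
  set Ds : ℕ → Set ℂ := Function.update D i (ball (0 : ℂ) R) with hDs
  have hTFs_i : TFs i = fun Z t s old φ => V i Z t old φ + (s / (ρ : ℂ)) * (TF i Z t z₀ old φ - V i Z t old φ) := by rw [hTFs, Function.update_self]
  have hTFs_ne : ∀ k' : ℕ, k' ≠ i → TFs k' = TF k' := fun k' hk => by rw [hTFs, Function.update_of_ne hk]
  have hDs_i : Ds i = ball (0 : ℂ) R := by rw [hDs, Function.update_self]
  have hDs_ne : ∀ k' : ℕ, k' ≠ i → Ds k' = D k' := fun k' hk => by rw [hDs, Function.update_of_ne hk]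
  have hDso : ∀ i', IsOpen (Ds i') := fun i' => by
    by_cases h : i' = i
    · subst h; rw [hDs_i]; exact isOpen_ball
    · rw [hDs_ne i' h]; exact hDo i'
  have hDsw : ∀ (i' : ℕ), ∀ t ∈ Ioc (0 : ℝ) γ, ((t : ℝ) : ℂ) ∈ Ds i' := fun i' t ht => by
    by_cases h : i' = i
    · subst h
      rw [hDs_i, mem_ball, dist_zero_right, Complex.norm_real, Real.norm_eq_abs, abs_of_pos ht.1]
      exact ht.2.trans_lt hγR
    · rw [hDs_ne i' h]; exact hDw i' t ht
  -- the norm of the affine combination on the ball: at most twice the weight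
  have haff : ∀ (s : ℂ), ‖s‖ ≤ R → ∀ (x y w : ℂ) (wt : ℝ), ‖y‖ ≤ wt → ‖x - y‖ ≤ q * wt → ‖y + s / (ρ : ℂ) * (x - y)‖ ≤ (1 + Ks) * wt := by
    intro s hs x y w wt hy hxy
    have hwt : 0 ≤ wt := (norm_nonneg _).trans hy
    have h1 : ‖s / (ρ : ℂ) * (x - y)‖ ≤ R / ρ * (q * wt) := by
      rw [norm_mul, norm_div, Complex.norm_real, Real.norm_eq_abs, abs_of_pos hρ0]
      exact mul_le_mul (div_le_div_of_nonneg_right hs hρ0.le) hxy (norm_nonneg _) (div_nonneg hR0.le hρ0.le)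
    have h2 : R / ρ * (q * wt) = Ks * wt := by
      have : R / ρ * q = Ks := by rw [div_mul_eq_mul_div, hRρ]; field_simp
      rw [← mul_assoc, this]
    calc ‖y + s / (ρ : ℂ) * (x - y)‖ ≤ ‖y‖ + ‖s / (ρ : ℂ) * (x - y)‖ := norm_add_le _ _
      _ ≤ wt + Ks * wt := add_le_add hy (h1.trans h2.le)
      _ = (1 + Ks) * wt := by ring
  -- R1a §2 for the interpolation tower at the letter a₅′
  have H1 := holoBound_recTerm_ofTerms F K L TFs sp c hL hLc hN hA0 hr₁ hκ hrate hsmall hrenew Ds hDso hDsw Kr ?_ ?_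
  rotate_left
  · -- (S-last-T′) for the interpolation tower
    intro k' hk old hold X' φ' hφ' Z hZ t ht
    by_cases hki : k' = i
    · subst hki
      rw [hTFs_i, hDs_i]
      refine ⟨?_, fun s hs => ?_⟩
      · exact ((differentiableOn_const _).add ((differentiableOn_id.div_const _).mul (differentiableOn_const _)))
      · refine hw_two k' Z t _ (haff s ?_ _ _ 0 _ (hVb k' hk old hold X' φ' hφ' Z hZ t ht) (hcen k' hk old hold X' φ' hφ' Z hZ t ht z₀ hz₀))
        rw [mem_ball, dist_zero_right] at hs
        exact hs.le
    · rw [hTFs_ne k' hki, hDs_ne k' hki]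
      obtain ⟨hd, hb⟩ := hlast k' hk old hold X' φ' hφ' Z hZ t ht
      exact ⟨hd, fun z hz => hw_up k' Z t _ (hb z hz)⟩
  · -- (S-226-T′) for the interpolation tower
    intro k' hk i' hi' u hu cv hcv X' φ' hφ' Z hZ t ht
    have hcvb : ∀ z ∈ Ds i', ∀ (j : Fin (k' + 1)) (Y : (domSys (F.P K) M j).Dom) (ψ : CPair (F.P K) 𝔸), ψ ∈ sp j Y →
        ‖cv z j Y ψ‖ ≤ A * Real.exp (-(κ * torusTreeLen Y.1)) := fun z hz j Y ψ hψ => (hcv j Y ψ hψ).2 z hz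
    by_cases hki : k' = i
    · subst hki
      have hi'ne : i' ≠ k' := Nat.ne_of_lt hi'
      rw [hTFs_i]
      rw [hDs_i, mem_ball, dist_zero_right] at hu
      rw [hDs_ne i' hi'ne] at hcv hcvb ⊢
      obtain ⟨hVd, hVbd⟩ := hpropV k' hk (D i') (hDo i') cv hcv X' φ' hφ' Z hZ t ht
      obtain ⟨hTd, -⟩ := hprop k' hk i' hi' (D i') (hDo i') z₀ hz₀ cv hcv X' φ' hφ' Z hZ t ht
      refine ⟨hVd.add ((differentiableOn_const _).mul (hTd.sub hVd)), fun z hz => ?_⟩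
      exact hw_two k' Z t _ (haff u hu.le _ _ 0 _ (hVbd z hz) (hcen k' hk (cv z) (hcvb z hz) X' φ' hφ' Z hZ t ht z₀ hz₀))
    · rw [hTFs_ne k' hki]
      rw [hDs_ne k' hki] at hu
      obtain ⟨hd, hb⟩ := hprop k' hk i' hi' (Ds i') (hDso i') u hu cv hcv X' φ' hφ' Z hZ t ht
      exact ⟨hd, fun z hz => hw_up k' Z t _ (hb z hz)⟩
  -- the section of the interpolation tower in the mock coupling: holomorphic on the ball, bounded by `A e^{−κ d}`
  obtain ⟨-, hsec⟩ := H1 j hj g hg X φ hφ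
  obtain ⟨hhol, hbd⟩ := hsec i hij
  rw [hDs_i] at hhol hbd
  set gc : ℕ → ℂ := fun n => ((g n : ℝ) : ℂ) with hgc
  set Φ : ℂ → ℂ := fun s => recTerm (GenTower.ofTerms L TFs) (Function.update gc i s) j X φ with hΦ
  -- its values at the two mock couplings
  have hΦρ : Φ (ρ : ℂ) = recTerm (GenTower.ofTerms L TF) (Function.update gc i z₀) j X φ := by
    refine recTerm_ofTerms_congr_step F K L i hTFs_ne (fun n hn => by rw [Function.update_of_ne hn, Function.update_of_ne hn]) (fun Z t old φ => ?_) j X φ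
    rw [hTFs_i, Function.update_self, Function.update_self]
    have hρc : (ρ : ℂ) ≠ 0 := Complex.ofReal_ne_zero.mpr hρ0.ne'
    field_simp
    ring
  have hΦ0 : Φ 0 = recTerm (GenTower.ofTerms L (Function.update TF i fun Z t _ old φ => V i Z t old φ)) gc j X φ := by
    refine recTerm_ofTerms_congr_step F K L i (fun k' hk => by rw [hTFs_ne k' hk, Function.update_of_ne hk])
      (fun n hn => by rw [Function.update_of_ne hn]) (fun Z t old φ => ?_) j X φ
    rw [hTFs_i, Function.update_self, Function.update_self]
    simp
  -- the Schwarz lemma on `ball 0 R`: the section maps the ball into the closed `2A e^{−κd}`-ball about its value at `0`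
  have hB0 : ‖Φ 0‖ ≤ A * Real.exp (-(κ * torusTreeLen X.1)) := hbd 0 (mem_ball_self hR0)
  have hmaps : MapsTo Φ (ball (0 : ℂ) R) (closedBall (Φ 0) (2 * (A * Real.exp (-(κ * torusTreeLen X.1))))) := fun s hs => by
    rw [mem_closedBall, dist_eq_norm]
    calc ‖Φ s - Φ 0‖ ≤ ‖Φ s‖ + ‖Φ 0‖ := norm_sub_le _ _
      _ ≤ A * Real.exp (-(κ * torusTreeLen X.1)) + A * Real.exp (-(κ * torusTreeLen X.1)) := add_le_add (hbd s hs) hB0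
      _ = 2 * (A * Real.exp (-(κ * torusTreeLen X.1))) := by ring
  have hρball : ((ρ : ℝ) : ℂ) ∈ ball (0 : ℂ) R := by
    rw [mem_ball, dist_zero_right, Complex.norm_real, Real.norm_eq_abs, abs_of_pos hρ0]
    exact hρR
  have key := Complex.dist_le_div_mul_dist_of_mapsTo_ball hhol hmaps hρball
  rw [dist_eq_norm, dist_zero_right, Complex.norm_real, Real.norm_eq_abs, abs_of_pos hρ0, hΦρ, hΦ0] at key
  calc ‖recTerm (GenTower.ofTerms L TF) (Function.update gc i z₀) j X φ -
          recTerm (GenTower.ofTerms L (Function.update TF i fun Z t _ old φ => V i Z t old φ)) gc j X φ‖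
      ≤ 2 * (A * Real.exp (-(κ * torusTreeLen X.1))) / R * ρ := key
    _ = 2 / Ks * (Mv * ‖z₀‖ ^ 2) * (A * Real.exp (-(κ * torusTreeLen X.1))) := by
        rw [← hqdef, hRdef]
        field_simp

end YMDAG.N22.W1

end
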